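import Literature.Computability.Complexity.MurrayWilliams2018Transfer
import Literature.Computability.Complexity.NTIMEMono
import Literature.Computability.Complexity.Williams2014AccSat
import HarnessLib

/-!
# Murray–Williams 2018: the Easy Witness Lemma for `NQP` (Lemma 1.3) at the tree's levels,
# derived from the Easy Witness Lemma for low nondeterministic time (Lemma 4.1)

Third layer under the named facts `MurrayWilliams2018_NQP_not_ACC`,
`MurrayWilliams2018_NQP_not_subset_ACC0`, `MurrayWilliams2018_NTIME_not_depth_ACC`
(`CircuitLowerBounds.lean`; C. D. Murray, R. R. Williams, *Circuit lower bounds for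
nondeterministic quasi-polytime: an easy witness lemma for NP and NQP*, STOC 2018, §1.1 and
Thm. 1.3). `MurrayWilliams2018Hierarchy.lean` proves the assembly of the source's Theorem 1.2 for
`AC⁰[m]` (`MurrayWilliams2018_thm_1_2_acc_of_EWL_of_simulation`) from two hypotheses: `hEWL` —
the easy witness lemma for `NQP` (Lemma 1.3, p. 4: "There is a `c ≥ 1` such that for all `k ≥ 1`,
if `NQP ⊂ SIZE[2^{logᵏ n}]` then every `L ∈ NQP` has witness circuits of size
`2^{c log^{k³} n}`"), read at the tree's levels `NTIME (n ^ (log₂ n)ᵉ)`, and `hN` — the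
nondeterministic simulation of §5; the hierarchy step is the tree's THEOREM
`Diag.ntime_hierarchy_holds` (`DiagMachine.lean`; the unary form of the hierarchy quoted on p. 14
of the source, Žák 1983, is not needed, the simulation never reading the letters of its input —
see the faithfulness notes of `MurrayWilliams2018Hierarchy.lean`). The source
obtains Lemma 1.3 as the case `s(n) = 2^{(log n)ᵏ}` of its main technical result, the Easy
Witness Lemma for low nondeterministic time (Lemma 4.1, p. 13: "For `s(n) = 2^{(log n)ᵏ}`,
`NQP ⊂ SIZE[2^{(log n)ᵏ}]` implies that `NQP` has witness circuits of size `2^{O((log n)^{k³})}`"),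
vendored as the named fact `MurrayWilliams2018_lemma_4_1_ae` (`MurrayWilliams2018EasyWitness.lean`,
the almost-everywhere form of the hypothesis, which is the form the printed proof establishes).

This file PROVES that derivation inside the tree:

* **`MurrayWilliams2018_lemma_1_3_of_lemma_4_1_ae`** — `MurrayWilliams2018_lemma_4_1_ae`
  implies hypothesis `hEWL` of the assembly verbatim (with `K = (k+2)³ + 1`, `e₀ = 1`).

The consequences for the three Murray–Williams facts over the remaining components — Lemma 4.1
(a.e. form), the simulation of §5 and Williams' `ACC`-SAT algorithm `Williams2014_thm_4_1`
(J. ACM 2014, Thm. 4.1; it gives Thm. 5.1, `MurrayWilliams2018_thm_5_1_of_thm_4_1`,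
`Williams2014AccSat.lean`) — are drawn downstream, in `MurrayWilliams2018Hierarchy.lean`
(`MurrayWilliams2018_thm_1_2_acc_of_lemma_4_1_ae_of_simulation` and its corollaries).

## The derivation

Lemma 4.1 quantifies over a strictly increasing time-constructible `s` (proviso (a):
`n · s(n) < 2^{n/e}` a.e.) and a non-decreasing time-constructible `t` (proviso (b):
`s₂(s₂(s₂(n)))ᵈ ≤ t(n)` a.e., `s₂(n) = s(e n)ᵉ`; "increasing `t`" as printed, see
`lemma_4_1_ae_monotone`), assumes `s`-size circuits a.e. for `NTIME (tᵉ)` and concludes that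
`NTIME t` has witness circuits of size `s₂(s₂(s₂(n)))^{2g}`. Fitting the tree's forms takes:

* `s = smoothQP k + id` (`smoothQP k n = 2^{qpExp k n} ≈ 2^{(log₂ n)^{k+1}}`, the
  smooth level of `SmoothQuasiPoly.lean`; `qpExp_mono`: the smooth exponent is monotone, so
  `s` is STRICTLY increasing; `isTimeConstructible_smoothQP_add_id` from the `FP` bricks;
  `2^{(log₂ n)ᵏ} ≤ s(n) ≤ 2^{(log₂ n + 2)^{k+2}}`; proviso (a): `eventually_mul_smoothQP_add_lt`);
* for the level `e`, `t = smoothQP E` with `E = (k+2)³ + e` (time constructible,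
  `isTimeConstructible_smoothQP`), NOT the level itself: the hypothesis of Lemma 4.1 concerns
  `NTIME (tᵉ')`, and **`NTIME_smoothQP_pow_subset`**: `NTIME ((smoothQP E ·)ᵉ') ⊆
  NTIME (n ^ (log₂ n)^{E+1})` (the power is time constructible, `isTimeConstructible_smoothQP_pow`,
  so its unary clock transports verifiers), where the assumed `2^{(log₂ n)ᵏ}`-size circuits live;
* the conclusion at `t = smoothQP E` descends to the level `e ≤ E - 1`:
  **`NTIMEHasWitnessCircuits.of_smoothQP`** — a verifier of the level is transported to the
  smooth level along the quasi-polynomial clock of `QuasiPolyClock.lean`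
  (`exists_qpClock_machine`), and the small witnesses of the transported verifier, cut at the
  original admissible length, are small witnesses of the original one;
* the arithmetic of `s₂(s₂(s₂(n)))`: bounds of the shape `2^{C (log₂ n + 2)^b}` are closed under
  stretching (`stretch_le_two_pow`, same `b`), composition (`comp_le_two_pow`, exponents
  multiply) and powers (`pow_le_two_pow`), and `C (log₂ n + 2)^b ≤ (log₂ n)^{b+1}` for large `n`
  (`eventually_mul_log_add_two_pow_le`); whence `s₂(s₂(s₂(n)))^{2g} ≤ 2^{(log₂ n)^{(k+2)³+1}}`
  and proviso (b) for `E ≥ (k+2)³`.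

The machine-level tool is **`NVerifier.exists_transport`**: a correct `t₁`-verifier `V` and a
clock machine `x ↦ ⟨x, 1^{c · t₁|x| + c}⟩` running in time `O(t₂)` give a correct `t₂`-verifier
with relation `V.rel x (y ↾ (c · t₁|x| + c))` (the truncating wrapper `truncMapAux` of
`TruncMapMachine.lean` followed by `V`'s machine — the construction of `NTIME_mono_holds` and of
`NTIME_pow_log_pow_subset_NTIME_two_pow_log_pow`, with the relation exposed), and
**`NTIME_subset_of_clocks`**, the resulting inclusion `NTIME t₁ ⊆ NTIME t₂`.

No notion, definition or named fact is introduced (theorems only).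

## References

* C. D. Murray, R. R. Williams, *Circuit lower bounds for nondeterministic quasi-polytime: an
  easy witness lemma for NP and NQP*, STOC 2018, 890–901 (ECCC TR17-188), Lemma 1.3 (p. 4),
  Lemma 4.1 (p. 13), §5 (proof of Thm. 1.2, p. 15: "by the Easy Witness Lemma for NQP …,
  `NTIME[t(n)]` has `2^{O(log^{k³} n)}`-size witness circuits") [MurrayWilliams2018].
* S. Arora, B. Barak, *Computational Complexity: A Modern Approach*, CUP 2009, §1.3
  (time-constructible functions), §2.1.2 and Thm. 2.6 (the verifier form of `NTIME`)
  [AroraBarak2009].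
* R. Williams, *Nonuniform ACC circuit lower bounds*, J. ACM 61 (2014), Thm. 4.1 [Williams2014].
* S. Žák, *A Turing machine time hierarchy*, Theoret. Comput. Sci. 26 (1983) 327–333 [Zak1983].
-/

noncomputable section

namespace Literature.Computability.Complexity

open _root_.Computability Turing Filter Asymptotics Polynomial

/-! ### Transport of verifiers along a clock -/

/-- **Transport of a verifier to a larger time bound along a clock.** Let `V` be a correct
`t₁`-time verifier for `L` with constant `c`, and let the machine `N` map every `x` to the pair
word `⟨x, 1^{c · t₁ |x| + c}⟩` (the admissible witness length of `V`, in unary) within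
`a · t₂ |x| + a` steps, where also `c · t₁ n + c ≤ a · t₂ n + a` and `n ≤ a · t₂ n + a`. Then `L`
has a correct `t₂`-time verifier whose relation is `V`'s relation on the witness CUT at `V`'s
admissible length: `rel' x y = V.rel x (y ↾ (c · t₁ |x| + c))` — the truncating wrapper
`truncMapAux N` (`TruncMapMachine.lean`: on `⟨x, y⟩` it outputs `⟨x, y ↾ (c · t₁ |x| + c)⟩`,
reading the discarded part of `y` two symbols per step) followed by `V`'s machine. This is the
machine behind every inclusion `NTIME t₁ ⊆ NTIME t₂` in the tree's one-constant verifier form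
of `NTIME` (`NTIME_mono_holds`, `NTIME_pow_log_pow_subset_NTIME_two_pow_log_pow`), with the new
relation made explicit so that witnesses of the new verifier can be cut back to witnesses of
`V` (Arora–Barak 2009, Thm. 2.6: the verifier ignores the part of the certificate it does not
need). [cite: AroraBarak2009, §2.1.2 and Thm. 2.6] -/
theorem NVerifier.exists_transport {t₁ t₂ : ℕ → ℕ} {L : Language Bool} (V : NVerifier t₁ L)
    (N : TM2ComputableAux Bool Bool) (a : ℕ)
    (hN : ∀ x : List Bool, N.OutputsWithin x
      (boolPair x (List.replicate (V.c * t₁ x.length + V.c) true)) (a * t₂ x.length + a))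
    (hw : ∀ n, V.c * t₁ n + V.c ≤ a * t₂ n + a) (hx : ∀ n, n ≤ a * t₂ n + a) :
    ∃ V' : NVerifier t₂ L, ∀ x y, V'.rel x y = V.rel x (y.take (V.c * t₁ x.length + V.c)) := by
  let M : TM2ComputableAux Bool Bool := (truncMapAux N).comp V.machine
  let W : List Bool → ℕ := fun x => V.c * t₁ x.length + V.c
  refine ⟨⟨18 * a + 24, fun x y => V.rel x (y.take (W x)), M, fun x y hy => ?_, fun x => ?_⟩,
    fun x y => rfl⟩
  · -- running time on an admissible pair of the new presentation
    have h₁ := outputsWithin_truncMapAux_boolPair N (y := y) (hN x)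
    simp only [List.length_replicate] at h₁
    have hy' : (y.take (W x)).length ≤ V.c * t₁ x.length + V.c := List.length_take_le _ _
    have h₂ : V.machine.OutputsWithin (boolPair x (y.take (W x)))
        (encodeBool (V.rel x (y.take (W x)))) (V.c * t₁ x.length + V.c) :=
      V.outputsWithin x _ hy'
    have h := Turing.TM2ComputableAux.comp_outputsWithin _ _ h₁ h₂
    refine h.mono ?_
    set n := x.length with hn
    set T := t₂ n with hT
    have hw' : V.c * t₁ n + V.c ≤ a * T + a := hw n
    have hx' : n ≤ a * T + a := hx n
    have hy2 : y.length ≤ (18 * a + 24) * T + (18 * a + 24) := hy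
    have e2 : (18 * a + 24) * T = 18 * (a * T) + 24 * T := by ring
    omega
  · -- the admissible witnesses certify the same inputs
    rw [V.mem_iff x]
    set n := x.length with hn
    constructor
    · rintro ⟨y, hy, hR⟩
      refine ⟨y, ?_, ?_⟩
      · show y.length ≤ (18 * a + 24) * t₂ n + (18 * a + 24)
        have hw' := hw n
        have e2 : (18 * a + 24) * t₂ n = 18 * (a * t₂ n) + 24 * t₂ n := by ring
        omega
      · show V.rel x (y.take (W x)) = true
        rwa [List.take_of_length_le hy]
    · rintro ⟨y, -, hR⟩
      exact ⟨y.take (W x), List.length_take_le _ _, hR⟩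

/-- **`NTIME t₁ ⊆ NTIME t₂` along clocks**: if for every constant `c ≥ 1` some machine produces
`⟨x, 1^{c · t₁ |x| + c}⟩` within `a · t₂ |x| + a` steps for an `a` with
`c · t₁ n + c ≤ a · t₂ n + a` and `n ≤ a · t₂ n + a`, then `NTIME t₁ ⊆ NTIME t₂`
(`NVerifier.exists_transport`; a presentation with `c = 0` is impossible, no machine halting in
`0` steps, `not_outputsWithin_zero`). [cite: AroraBarak2009, §2.1.2 and Thm. 2.6] -/
theorem NTIME_subset_of_clocks {t₁ t₂ : ℕ → ℕ}
    (h : ∀ c : ℕ, 1 ≤ c → ∃ (N : TM2ComputableAux Bool Bool) (a : ℕ),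
      (∀ x : List Bool, N.OutputsWithin x
        (boolPair x (List.replicate (c * t₁ x.length + c) true)) (a * t₂ x.length + a)) ∧
      (∀ n, c * t₁ n + c ≤ a * t₂ n + a) ∧ (∀ n, n ≤ a * t₂ n + a)) :
    NTIME t₁ ⊆ NTIME t₂ := by
  intro L hL
  obtain ⟨V⟩ := mem_NTIME_iff_nonempty_nVerifier.1 hL
  rcases Nat.eq_zero_or_pos V.c with hc | hc
  · have h0 := V.outputsWithin [] [] (by simp)
    rw [hc] at h0
    exact (not_outputsWithin_zero V.machine _ _ (by simpa using h0)).elim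
  obtain ⟨N, a, hN, hw, hx⟩ := h V.c hc
  obtain ⟨V', -⟩ := V.exists_transport N a hN hw hx
  exact mem_NTIME_iff_nonempty_nVerifier.2 ⟨V'⟩

/-! ### Time constructibility from `FP` -/

/-- A function `g ≥ id` computed from `1ⁿ` in polynomial time by a machine whose polynomial is
`O(g)` is time constructible (Arora–Barak 2009, §1.3: a function computable from `1ⁿ` in time
`O(T(n))`, `T(n) ≥ n`, is time constructible) — the argument of `isTimeConstructible_smoothQP`.
[cite: AroraBarakCC2009, §1.3 (p. 16)] -/
theorem isTimeConstructible_of_polyTimeComputable {g : ℕ → ℕ}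
    (hg : PolyTimeComputable unaryEncodeNat encodeNat g)
    (hdom : ∀ p : Polynomial ℕ, ∃ c : ℕ, ∀ n : ℕ, p.eval n ≤ c * g n + c) (hge : ∀ n, n ≤ g n) :
    IsTimeConstructible g := by
  refine ⟨hge, ?_⟩
  obtain ⟨p, M, hM⟩ := hg
  obtain ⟨c, hc⟩ := hdom p
  refine ⟨c, M, fun n => (hM n).mono ?_⟩
  have hl : (unaryEncodeNat n).length = n := by
    rw [OracleCompose.unaryEncodeNat_eq_replicate, List.length_replicate]
  simp only [hl]
  exact hc n

/-- **Powers of the smooth quasi-polynomial level are time constructible**: `1 ≤ E`, `1 ≤ e` ⟹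
`IsTimeConstructible (smoothQP E · ^ e)` (`1ⁿ ↦ bin ((smoothQP E n)ᵉ)` is the `FP` brick
`natPowFn e ∘ smoothQPFn E`; every polynomial is `O(smoothQP E)`, `exists_poly_le_smoothQP`).
[cite: AroraBarakCC2009, §1.3 (p. 16)] -/
theorem isTimeConstructible_smoothQP_pow {E e : ℕ} (hE : 1 ≤ E) (he : 1 ≤ e) :
    IsTimeConstructible fun n => smoothQP E n ^ e := by
  have hFP : Brick.natPowFn e ∘ Brick.smoothQPFn E ∈ FP :=
    comp_mem_FP (Brick.natPowFn_mem_FP e) (Brick.smoothQPFn_mem_FP E)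
  have hpt : PolyTimeComputable unaryEncodeNat encodeNat fun n => smoothQP E n ^ e :=
    PolyTimeComputable.of_encode hFP unaryEncodeNat (fun _ => rfl) fun n => by
      simp only [Function.comp_apply, Brick.smoothQPFn_unary, Brick.natPowFn_apply,
        bitsToNat_encodeNat, id]
  have hle : ∀ n, smoothQP E n ≤ smoothQP E n ^ e := fun n => Nat.le_self_pow (by omega) _
  refine isTimeConstructible_of_polyTimeComputable hpt (fun p => ?_) fun n =>
    (le_smoothQP E n).trans (hle n)
  obtain ⟨c, hc⟩ := exists_poly_le_smoothQP hE p
  exact ⟨c, fun n => (hc n).trans (by have := hle n; nlinarith)⟩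

/-! ### The size function fed to Lemma 4.1: `s(n) = smoothQP k n + n`

The size function of the application of Lemma 4.1 is `n ↦ smoothQP k n + n`
(`≈ 2^{(log₂ n)^{k+1}}`; the summand `n` makes it STRICTLY increasing, as Lemma 4.1 requires of
`s`, the smooth level itself being only monotone). It is kept as an explicit lambda. -/

/-- The exponent `qpExp E` is monotone in `n` (within a dyadic block the interpolation term
grows; across the boundary `n + 1 = 2^{j+1}` the upper sandwich at `n` meets the lower sandwich
at `n + 1`). [folklore] -/
theorem qpExp_mono (E : ℕ) : Monotone (qpExp E) := by
  refine monotone_nat_of_le_succ fun n => ?_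
  have hlt : n + 1 ≤ 2 ^ (Nat.log 2 n + 1) := Nat.lt_pow_succ_log_self one_lt_two n
  rcases hlt.lt_or_eq with h | h
  · -- same dyadic block
    have hlog : Nat.log 2 (n + 1) = Nat.log 2 n := by
      apply Nat.log_eq_of_pow_le_of_lt_pow
      · rcases Nat.eq_zero_or_pos n with rfl | hn
        · simp
        · exact (Nat.pow_log_le_self 2 hn.ne').trans (Nat.le_succ n)
      · exact h
    unfold qpExp
    rw [hlog]
    gcongr
    omega
  · -- boundary
    have hlog : Nat.log 2 (n + 1) = Nat.log 2 n + 1 := by rw [h, Nat.log_pow one_lt_two]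
    calc qpExp E n ≤ Nat.log 2 n + 1 + (Nat.log 2 n + 1) ^ (E + 1) := qpExp_le E n
      _ ≤ Nat.log 2 (n + 1) + 1 + Nat.log 2 (n + 1) ^ (E + 1) := by rw [hlog]; omega
      _ ≤ qpExp E (n + 1) := qpExp_ge E (n + 1)

/-- The smooth level `smoothQP E` is monotone. [folklore] -/
theorem smoothQP_mono (E : ℕ) : Monotone (smoothQP E) := fun _ _ h =>
  Nat.pow_le_pow_right two_pos (qpExp_mono E h)

/-- `n ↦ smoothQP k n + n` is strictly increasing. [folklore] -/
theorem strictMono_smoothQP_add_id (k : ℕ) : StrictMono (fun n => smoothQP k n + n) :=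
  fun _ _ h => Nat.add_lt_add_of_le_of_lt (smoothQP_mono k h.le) h

/-- `n ↦ smoothQP k n + n` is time constructible (`1 ≤ k`): `1ⁿ ↦ bin (smoothQP k n + n)` is
the `FP` brick `addFn ∘ ⟨smoothQPFn k, popCount⟩`. [cite: AroraBarakCC2009, §1.3 (p. 16)] -/
theorem isTimeConstructible_smoothQP_add_id {k : ℕ} (hk : 1 ≤ k) :
    IsTimeConstructible fun n => smoothQP k n + n := by
  have hFP : Brick.addFn ∘ fanoutFn (Brick.smoothQPFn k) Brick.qpN ∈ FP :=
    comp_mem_FP Brick.addFn_mem_FP (fanoutFn_mem_FP (Brick.smoothQPFn_mem_FP k) Brick.qpN_mem_FP)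
  have hpt : PolyTimeComputable unaryEncodeNat encodeNat fun n => smoothQP k n + n :=
    PolyTimeComputable.of_encode hFP unaryEncodeNat (fun _ => rfl) fun n => by
      simp only [Function.comp_apply, fanoutFn_apply, Brick.smoothQPFn_unary, Brick.qpN_unary,
        Brick.addFn_boolPair, bitsToNat_encodeNat, id]
  refine isTimeConstructible_of_polyTimeComputable hpt (fun p => ?_) fun n => Nat.le_add_left _ _
  obtain ⟨c, hc⟩ := exists_poly_le_smoothQP hk p
  exact ⟨c, fun n => (hc n).trans (by nlinarith)⟩

/-- `(L+2)^m + (L+2) ≤ (L+2)^{m+1}` for `1 ≤ m`. [folklore] -/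
theorem pow_add_base_le_pow_succ (L : ℕ) {m : ℕ} (hm : 1 ≤ m) :
    (L + 2) ^ m + (L + 2) ≤ (L + 2) ^ (m + 1) := by
  have h2 : L + 2 ≤ (L + 2) ^ m := Nat.le_self_pow (by omega) _
  calc (L + 2) ^ m + (L + 2) ≤ (L + 2) ^ m + (L + 2) ^ m := Nat.add_le_add_left h2 _
    _ = (L + 2) ^ m * 2 := by ring
    _ ≤ (L + 2) ^ m * (L + 2) := Nat.mul_le_mul_left _ (by omega)
    _ = (L + 2) ^ (m + 1) := by ring

/-- `L + 2 + (L+1)^{k+1} ≤ (L+2)^{k+2}`. [folklore] -/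
theorem log_add_pow_le (L k : ℕ) : L + 2 + (L + 1) ^ (k + 1) ≤ (L + 2) ^ (k + 2) := by
  have h1 : (L + 1) ^ (k + 1) ≤ (L + 2) ^ (k + 1) := Nat.pow_le_pow_left (by omega) _
  have h2 : (L + 2) ^ (k + 1) + (L + 2) ≤ (L + 2) ^ (k + 2) :=
    pow_add_base_le_pow_succ L (m := k + 1) (by omega)
  omega

/-- Lower bound: `2^{(log₂ n)ᵏ} ≤ smoothQP k n + n` (`1 ≤ k`). [folklore] -/
theorem two_pow_log_pow_le_smoothQP_add {k : ℕ} (hk : 1 ≤ k) (n : ℕ) :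
    2 ^ Nat.log 2 n ^ k ≤ smoothQP k n + n := by
  have h1 : Nat.log 2 n ^ k ≤ Nat.log 2 n ^ (k + 1) := by
    rcases Nat.eq_zero_or_pos (Nat.log 2 n) with hl | hl
    · rw [hl, zero_pow (by omega), zero_pow (by omega)]
    · exact Nat.pow_le_pow_right hl (Nat.le_succ k)
  calc 2 ^ Nat.log 2 n ^ k ≤ 2 ^ qpExp k n :=
        Nat.pow_le_pow_right two_pos (h1.trans (pow_log_le_qpExp k n))
    _ ≤ smoothQP k n + n := Nat.le_add_right _ _

/-- Upper bound: `smoothQP k n + n ≤ 2^{(log₂ n + 2)^{k+2}}` at every `n`. [folklore] -/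
theorem smoothQP_add_le_two_pow (k n : ℕ) :
    smoothQP k n + n ≤ 2 ^ (1 * (Nat.log 2 n + 2) ^ (k + 2)) := by
  set L := Nat.log 2 n with hL
  have hq : qpExp k n ≤ L + 1 + (L + 1) ^ (k + 1) := qpExp_le k n
  have hn : n ≤ 2 ^ (L + 1) := (Nat.lt_pow_succ_log_self one_lt_two n).le
  have hn' : n ≤ 2 ^ (L + 1 + (L + 1) ^ (k + 1)) :=
    hn.trans (Nat.pow_le_pow_right two_pos (Nat.le_add_right _ _))
  calc smoothQP k n + n = 2 ^ qpExp k n + n := rfl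
    _ ≤ 2 ^ (L + 1 + (L + 1) ^ (k + 1)) + 2 ^ (L + 1 + (L + 1) ^ (k + 1)) :=
        Nat.add_le_add (Nat.pow_le_pow_right two_pos hq) hn'
    _ = 2 ^ (L + 2 + (L + 1) ^ (k + 1)) := by
        rw [← two_mul, show L + 2 + (L + 1) ^ (k + 1) = (L + 1 + (L + 1) ^ (k + 1)) + 1 by ring,
          pow_succ]; ring
    _ ≤ 2 ^ (1 * (L + 2) ^ (k + 2)) := by
        rw [one_mul]; exact Nat.pow_le_pow_right two_pos (log_add_pow_le L k)

/-! ### Quasi-polynomial bounds `2^{C (log₂ n + 2)^b}`: closure under stretching, composition, powers -/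

/-- `log₂ e ≤ e`. [folklore] -/
theorem log_two_le_self (e : ℕ) : Nat.log 2 e ≤ e := by
  rcases Nat.eq_zero_or_pos e with rfl | he
  · simp
  · exact (Nat.log_lt_of_lt_pow' he.ne' Nat.lt_two_pow_self).le

/-- `log₂ (e · n) ≤ log₂ e + log₂ n + 1`. [folklore] -/
theorem log_mul_le (e n : ℕ) : Nat.log 2 (e * n) ≤ Nat.log 2 e + Nat.log 2 n + 1 := by
  have h1 : e < 2 ^ (Nat.log 2 e + 1) := Nat.lt_pow_succ_log_self one_lt_two e
  have h2 : n < 2 ^ (Nat.log 2 n + 1) := Nat.lt_pow_succ_log_self one_lt_two n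
  have h3 : e * n < 2 ^ (Nat.log 2 e + Nat.log 2 n + 1 + 1) := by
    calc e * n ≤ e * 2 ^ (Nat.log 2 n + 1) := Nat.mul_le_mul_left e h2.le
      _ < 2 ^ (Nat.log 2 e + 1) * 2 ^ (Nat.log 2 n + 1) :=
          Nat.mul_lt_mul_of_pos_right h1 (Nat.two_pow_pos _)
      _ = 2 ^ (Nat.log 2 e + Nat.log 2 n + 1 + 1) := by rw [← pow_add]; ring_nf
  exact Nat.lt_succ_iff.1 (Nat.log_lt_of_lt_pow' (by omega) h3)

/-- **Stretching** (`s₂(n) = s(e n)ᵉ` of Lemma 4.1) keeps the shape of the bound: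
`f ≤ 2^{C (log₂ n + 2)^b}` everywhere gives `stretch f e ≤ 2^{e C (e+2)^b (log₂ n + 2)^b}`
everywhere. [folklore] -/
theorem stretch_le_two_pow {f : ℕ → ℕ} {C b : ℕ}
    (hf : ∀ n, f n ≤ 2 ^ (C * (Nat.log 2 n + 2) ^ b)) (e n : ℕ) :
    stretch f e n ≤ 2 ^ ((e * C * (e + 2) ^ b) * (Nat.log 2 n + 2) ^ b) := by
  rw [stretch_apply]
  have hlog : Nat.log 2 (e * n) + 2 ≤ (e + 2) * (Nat.log 2 n + 2) := by
    have h1 := log_mul_le e n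
    have h2 := log_two_le_self e
    have h3 : (e + 2) * (Nat.log 2 n + 2) = e * Nat.log 2 n + 2 * e + 2 * Nat.log 2 n + 4 := by
      ring
    have h4 : 0 ≤ e * Nat.log 2 n := Nat.zero_le _
    omega
  calc f (e * n) ^ e ≤ (2 ^ (C * (Nat.log 2 (e * n) + 2) ^ b)) ^ e := Nat.pow_le_pow_left (hf _) e
    _ = 2 ^ (e * (C * (Nat.log 2 (e * n) + 2) ^ b)) := by rw [← pow_mul, mul_comm]
    _ ≤ 2 ^ ((e * C * (e + 2) ^ b) * (Nat.log 2 n + 2) ^ b) := by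
        refine Nat.pow_le_pow_right two_pos ?_
        have h3 : (Nat.log 2 (e * n) + 2) ^ b ≤ ((e + 2) * (Nat.log 2 n + 2)) ^ b :=
          Nat.pow_le_pow_left hlog b
        rw [mul_pow] at h3
        calc e * (C * (Nat.log 2 (e * n) + 2) ^ b)
            ≤ e * (C * ((e + 2) ^ b * (Nat.log 2 n + 2) ^ b)) := by gcongr
          _ = e * C * (e + 2) ^ b * (Nat.log 2 n + 2) ^ b := by ring

/-- **Composition** keeps the shape of the bound: `f ≤ 2^{C (log₂ n + 2)^b}` and
`g ≤ 2^{D (log₂ n + 2)^{b'}}` everywhere give `f ∘ g ≤ 2^{C (D+2)^b (log₂ n + 2)^{b' b}}`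
everywhere (`log₂ (g n) ≤ D (log₂ n + 2)^{b'}`). [folklore] -/
theorem comp_le_two_pow {f g : ℕ → ℕ} {C b D b' : ℕ}
    (hf : ∀ n, f n ≤ 2 ^ (C * (Nat.log 2 n + 2) ^ b))
    (hg : ∀ n, g n ≤ 2 ^ (D * (Nat.log 2 n + 2) ^ b')) (n : ℕ) :
    f (g n) ≤ 2 ^ ((C * (D + 2) ^ b) * (Nat.log 2 n + 2) ^ (b' * b)) := by
  have h1 : Nat.log 2 (g n) ≤ D * (Nat.log 2 n + 2) ^ b' := by
    have := Nat.log_mono_right (b := 2) (hg n)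
    rwa [Nat.log_pow one_lt_two] at this
  have hP : 1 ≤ (Nat.log 2 n + 2) ^ b' := Nat.one_le_pow _ _ (by omega)
  have h2 : Nat.log 2 (g n) + 2 ≤ (D + 2) * (Nat.log 2 n + 2) ^ b' := by
    have e1 : (D + 2) * (Nat.log 2 n + 2) ^ b' =
        D * (Nat.log 2 n + 2) ^ b' + 2 * (Nat.log 2 n + 2) ^ b' := by ring
    omega
  calc f (g n) ≤ 2 ^ (C * (Nat.log 2 (g n) + 2) ^ b) := hf _
    _ ≤ 2 ^ ((C * (D + 2) ^ b) * (Nat.log 2 n + 2) ^ (b' * b)) := by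
        refine Nat.pow_le_pow_right two_pos ?_
        have h3 : (Nat.log 2 (g n) + 2) ^ b ≤ ((D + 2) * (Nat.log 2 n + 2) ^ b') ^ b :=
          Nat.pow_le_pow_left h2 b
        rw [mul_pow, ← pow_mul] at h3
        calc C * (Nat.log 2 (g n) + 2) ^ b ≤ C * ((D + 2) ^ b * (Nat.log 2 n + 2) ^ (b' * b)) :=
              Nat.mul_le_mul_left C h3
          _ = C * (D + 2) ^ b * (Nat.log 2 n + 2) ^ (b' * b) := by ring

/-- **Powers** keep the shape of the bound. [folklore] -/
theorem pow_le_two_pow {f : ℕ → ℕ} {C b : ℕ} (hf : ∀ n, f n ≤ 2 ^ (C * (Nat.log 2 n + 2) ^ b))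
    (d n : ℕ) : f n ^ d ≤ 2 ^ ((d * C) * (Nat.log 2 n + 2) ^ b) := by
  calc f n ^ d ≤ (2 ^ (C * (Nat.log 2 n + 2) ^ b)) ^ d := Nat.pow_le_pow_left (hf n) d
    _ = 2 ^ ((d * C) * (Nat.log 2 n + 2) ^ b) := by rw [← pow_mul]; congr 1; ring

/-- **The shape is quasi-polynomial**: `C (log₂ n + 2)^b ≤ (log₂ n)^{b+1}` for all large `n`
(`log₂ n ≥ C 2^b + 2`). [folklore] -/
theorem eventually_mul_log_add_two_pow_le (C b : ℕ) :
    ∀ᶠ n in atTop, C * (Nat.log 2 n + 2) ^ b ≤ Nat.log 2 n ^ (b + 1) := by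
  refine eventually_atTop.2 ⟨2 ^ (C * 2 ^ b + 2), fun n hn => ?_⟩
  have hL : C * 2 ^ b + 2 ≤ Nat.log 2 n := le_log_of_two_pow_le hn
  set L := Nat.log 2 n
  calc C * (L + 2) ^ b ≤ C * (2 * L) ^ b := by gcongr; omega
    _ = C * 2 ^ b * L ^ b := by rw [mul_pow]; ring
    _ ≤ L * L ^ b := Nat.mul_le_mul_right _ (by omega)
    _ = L ^ (b + 1) := by ring

/-- From an eventual inequality to an everywhere one with an additive constant. [folklore] -/
theorem exists_add_of_eventually_le {f g : ℕ → ℕ} (h : ∀ᶠ n in atTop, f n ≤ g n) :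
    ∃ A : ℕ, ∀ n, f n ≤ g n + A := by
  obtain ⟨N, hN⟩ := eventually_atTop.1 h
  refine ⟨∑ i ∈ Finset.range N, f i, fun n => ?_⟩
  rcases Nat.lt_or_ge n N with hn | hn
  · exact (Finset.single_le_sum (f := fun i => f i) (fun i _ => Nat.zero_le (f i))
      (Finset.mem_range.2 hn)).trans (Nat.le_add_left _ _)
  · exact (hN n hn).trans (Nat.le_add_right _ _)

/-- Monotonicity of `(log₂ n)^a` in the exponent `a ≥ 1` (also at `log₂ n = 0`). [folklore] -/
theorem log_pow_mono {a b : ℕ} (ha : 1 ≤ a) (hab : a ≤ b) (n : ℕ) :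
    Nat.log 2 n ^ a ≤ Nat.log 2 n ^ b := by
  rcases Nat.eq_zero_or_pos (Nat.log 2 n) with hl | hl
  · rw [hl, zero_pow (by omega), zero_pow (by omega)]
  · exact Nat.pow_le_pow_right hl hab

/-- **Proviso (a) of Lemma 4.1 for `s(n) = smoothQP k n + n`**: `n · s(n) < 2^{n/e}` for all
large `n` (`s` is quasi-polynomial, `2^{n/e}` is not). [cite: MurrayWilliams2018, Lemma 4.1 (a)] -/
theorem eventually_mul_smoothQP_add_lt (k : ℕ) {e : ℕ} (he : 1 ≤ e) :
    ∀ᶠ n in atTop, n * (smoothQP k n + n) < 2 ^ (n / e) := by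
  obtain ⟨j₀, hj₀⟩ := exists_pow_succ_le_two_pow (k + 3)
  filter_upwards [eventually_mul_log_add_two_pow_le e (k + 3), eventually_ge_atTop (2 ^ j₀),
    eventually_ge_atTop 1] with n h1 h2 h3
  have hs := smoothQP_add_le_two_pow k n
  rw [one_mul] at hs
  have hnlt : n < 2 ^ (Nat.log 2 n + 1) := Nat.lt_pow_succ_log_self one_lt_two n
  set L := Nat.log 2 n with hL
  have hj : j₀ ≤ L := le_log_of_two_pow_le h2
  have hn2 : 2 ^ L ≤ n := Nat.pow_log_le_self 2 (by omega)
  have hexp : (L + 2) ^ (k + 3) ≤ n / e := by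
    rw [Nat.le_div_iff_mul_le (by omega)]
    calc (L + 2) ^ (k + 3) * e = e * (L + 2) ^ (k + 3) := mul_comm _ _
      _ ≤ L ^ (k + 3 + 1) := h1
      _ ≤ (L + 1) ^ (k + 3 + 1) := Nat.pow_le_pow_left (Nat.le_succ L) _
      _ ≤ 2 ^ L := hj₀ L hj
      _ ≤ n := hn2
  have hpow : L + 1 + (L + 2) ^ (k + 2) ≤ (L + 2) ^ (k + 3) := by
    have h' : (L + 2) ^ (k + 2) + (L + 2) ≤ (L + 2) ^ (k + 3) :=
      pow_add_base_le_pow_succ L (m := k + 2) (by omega)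
    omega
  calc n * (smoothQP k n + n) ≤ n * 2 ^ ((L + 2) ^ (k + 2)) := Nat.mul_le_mul_left n hs
    _ < 2 ^ (L + 1) * 2 ^ ((L + 2) ^ (k + 2)) :=
        Nat.mul_lt_mul_of_pos_right hnlt (Nat.two_pow_pos _)
    _ = 2 ^ (L + 1 + (L + 2) ^ (k + 2)) := by rw [← pow_add]
    _ ≤ 2 ^ ((L + 2) ^ (k + 3)) := Nat.pow_le_pow_right two_pos hpow
    _ ≤ 2 ^ (n / e) := Nat.pow_le_pow_right two_pos hexp

/-! ### The two transfers between the tree's levels and the smooth levels -/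

/-- `2^{(log₂ n)^{e+2}} ≤ smoothQP E n` for `e + 1 ≤ E`. [folklore] -/
theorem two_pow_log_pow_le_smoothQP {e E : ℕ} (h : e + 1 ≤ E) (n : ℕ) :
    2 ^ Nat.log 2 n ^ (e + 2) ≤ smoothQP E n :=
  Nat.pow_le_pow_right two_pos ((log_pow_mono (by omega) (by omega) n).trans (pow_log_le_qpExp E n))

/-- **Hypothesis transfer: `NTIME ((smoothQP E ·)ᵉ) ⊆ NTIME (n ^ (log₂ n)^{E+1})`** (`1 ≤ E`,
`1 ≤ e`): `(smoothQP E n)ᵉ = 2^{e · qpExp E n} ≤ 2^{(log₂ n)^{E+2}} ≤ n^{(log₂ n)^{E+1}}` for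
all large `n`, the power is time constructible (`isTimeConstructible_smoothQP_pow`), so its
unary clock (`exists_unaryClock_of_timeConstructible`) transports verifiers
(`NTIME_subset_of_clocks`). [cite: AroraBarak2009, §2.1.2 and Thm. 2.6] -/
theorem NTIME_smoothQP_pow_subset {E e : ℕ} (hE : 1 ≤ E) (he : 1 ≤ e) :
    NTIME (fun n => smoothQP E n ^ e) ⊆ NTIME (fun n => n ^ Nat.log 2 n ^ (E + 1)) := by
  have hev : ∀ᶠ n in atTop, smoothQP E n ^ e ≤ n ^ Nat.log 2 n ^ (E + 1) := by
    filter_upwards [eventually_mul_log_add_two_pow_le (2 * e) (E + 1), eventually_ge_atTop 1]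
      with n h1 h2
    set L := Nat.log 2 n with hL
    have hq : qpExp E n ≤ L + 1 + (L + 1) ^ (E + 1) := qpExp_le E n
    have h3 : e * qpExp E n ≤ L ^ (E + 1 + 1) := by
      have h5 : L + 1 ≤ (L + 2) ^ (E + 1) :=
        (Nat.le_succ _).trans (Nat.le_self_pow (by omega) _)
      have h6 : (L + 1) ^ (E + 1) ≤ (L + 2) ^ (E + 1) := Nat.pow_le_pow_left (by omega) _
      calc e * qpExp E n ≤ e * (2 * (L + 2) ^ (E + 1)) := Nat.mul_le_mul_left e (by omega)
        _ = 2 * e * (L + 2) ^ (E + 1) := by ring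
        _ ≤ L ^ (E + 1 + 1) := h1
    have hn2 : 2 ^ L ≤ n := Nat.pow_log_le_self 2 (by omega)
    calc smoothQP E n ^ e = 2 ^ (e * qpExp E n) := by rw [smoothQP, ← pow_mul, mul_comm]
      _ ≤ 2 ^ (L ^ (E + 1 + 1)) := Nat.pow_le_pow_right two_pos h3
      _ = (2 ^ L) ^ (L ^ (E + 1)) := by rw [← pow_mul]; congr 1; ring
      _ ≤ n ^ (L ^ (E + 1)) := Nat.pow_le_pow_left hn2 _
  obtain ⟨A, hA⟩ := exists_add_of_eventually_le hev
  have htc := isTimeConstructible_smoothQP_pow hE he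
  refine NTIME_subset_of_clocks fun c hc => ?_
  obtain ⟨N, a, hN⟩ := exists_unaryClock_of_timeConstructible (htc.mul_add hc)
  refine ⟨N, a * c + (a * c * A + a * c + a) + (c * A + c) + 1, fun x => (hN x).mono ?_,
    fun n => ?_, fun n => ?_⟩
  · set n := x.length
    have h := hA n
    calc a * (c * smoothQP E n ^ e + c) + a ≤ a * (c * (n ^ Nat.log 2 n ^ (E + 1) + A) + c) + a := by
          gcongr
      _ = (a * c) * n ^ Nat.log 2 n ^ (E + 1) + (a * c * A + a * c + a) := by ring
      _ ≤ _ := Nat.add_le_add (Nat.mul_le_mul_right _ (by omega)) (by omega)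
  · have h := hA n
    calc c * smoothQP E n ^ e + c ≤ c * (n ^ Nat.log 2 n ^ (E + 1) + A) + c := by gcongr
      _ = c * n ^ Nat.log 2 n ^ (E + 1) + (c * A + c) := by ring
      _ ≤ _ := Nat.add_le_add (Nat.mul_le_mul_right _ (by omega)) (by omega)
  · calc n ≤ n ^ Nat.log 2 n ^ (E + 1) := (ExpPad.sizes_le_pow_pow_log (E + 1) n).1
      _ ≤ _ := (Nat.le_mul_of_pos_left _ (by omega)).trans (Nat.le_add_right _ _)

/-- **Conclusion transfer: witness circuits descend from a smooth level to the tree's levels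
below it.** If `NTIME (smoothQP E)` has witness circuits of size `w`, then so does
`NTIME (n ^ (log₂ n)ᵉ)` for `e + 1 ≤ E`: a verifier `V` of the level is transported to the
smooth level along the quasi-polynomial clock of `QuasiPolyClock.lean` (`exists_qpClock_machine`,
time `O(2^{(log₂ n)^{e+2}}) ≤ O(smoothQP E n)`), the transported verifier has small witnesses,
and cutting them at `V`'s admissible length gives small witnesses for `V` (a prefix of a prefix
of a truth table). [cite: MurrayWilliams2018, §2 (Witness Circuits)] -/
theorem NTIMEHasWitnessCircuits.of_smoothQP {E e : ℕ} {w : ℕ → ℕ} (hEe : e + 1 ≤ E)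
    (h : NTIMEHasWitnessCircuits (smoothQP E) w) :
    NTIMEHasWitnessCircuits (fun n => n ^ Nat.log 2 n ^ e) w := by
  intro L _ V
  obtain ⟨C, N, hN⟩ := exists_qpClock_machine V.c e
  set D₁ := (2 ^ (1 + 1)) ^ ((1 + 1) ^ e * 1) with hD₁
  have hlev : ∀ n : ℕ, n ^ Nat.log 2 n ^ e ≤ smoothQP E n + D₁ := fun n => by
    have h1 : (n ^ Nat.log 2 n ^ e) ^ 1 ≤ 2 ^ Nat.log 2 n ^ (e + 2) + D₁ :=
      ExpPad.pow_pow_log_pow_le_add e 1 n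
    rw [pow_one] at h1
    exact h1.trans (Nat.add_le_add_right (two_pow_log_pow_le_smoothQP hEe n) _)
  set a := C + (V.c * D₁ + V.c) + 1 with ha
  have hN' : ∀ x : List Bool, N.OutputsWithin x
      (boolPair x (List.replicate (V.c * x.length ^ Nat.log 2 x.length ^ e + V.c) true))
      (a * smoothQP E x.length + a) := fun x => by
    refine (hN x).mono ?_
    calc C * 2 ^ Nat.log 2 x.length ^ (e + 2) + C ≤ C * smoothQP E x.length + C :=
          Nat.add_le_add_right (Nat.mul_le_mul_left C (two_pow_log_pow_le_smoothQP hEe _)) C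
      _ ≤ a * smoothQP E x.length + a := Nat.add_le_add (Nat.mul_le_mul_right _ (by omega)) (by omega)
  have hw : ∀ n, V.c * n ^ Nat.log 2 n ^ e + V.c ≤ a * smoothQP E n + a := fun n => by
    calc V.c * n ^ Nat.log 2 n ^ e + V.c ≤ V.c * (smoothQP E n + D₁) + V.c := by gcongr; exact hlev n
      _ = V.c * smoothQP E n + (V.c * D₁ + V.c) := by ring
      _ ≤ a * smoothQP E n + a := Nat.add_le_add (Nat.mul_le_mul_right _ (by omega)) (by omega)
  have hx : ∀ n, n ≤ a * smoothQP E n + a := fun n =>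
    (le_smoothQP E n).trans ((Nat.le_mul_of_pos_left _ (by omega)).trans (Nat.le_add_right _ _))
  obtain ⟨V', hV'⟩ := V.exists_transport N a hN' hw hx
  obtain ⟨n₀, hn₀⟩ := h L (mem_NTIME_iff_nonempty_nVerifier.2 ⟨V'⟩) V'
  refine ⟨n₀, fun x hx hle => ?_⟩
  obtain ⟨m, W, y, hW, hsz, -, hrel, hpre⟩ := hn₀ x hx hle
  refine ⟨m, W, y.take (V.c * x.length ^ Nat.log 2 x.length ^ e + V.c), hW, hsz,
    List.length_take_le _ _, ?_, (List.take_prefix _ _).trans hpre⟩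
  rw [← hV' x y]
  exact hrel

/-! ### Lemma 1.3 at the tree's levels -/

/-- **Lemma 4.1 with the printed hypothesis "`t` increasing".** The printed Lemma 4.1
quantifies over "increasing time-constructible `s(n)` … and `t(n)`", and its proof uses that
`t` is non-decreasing in its last display (ECCC TR17-188, p. 14: on inputs of length
`s′₂(nᵢ)` the simulation `N` "runs in time `… ≤ O(t(nᵢ)^{a+g}) ≤ O(t(s′₂(nᵢ))^{a+g})`").
This adapter states the lemma WITH `Monotone t` and derives it from the named fact
`MurrayWilliams2018_lemma_4_1_ae`; its tactic proof discharges the provisos of the fact goal by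
goal from the context, so that it elaborates whether or not the fact itself carries the
hypothesis `Monotone t` (it is being restated to carry it; D-0026 review of 2026-08-15, see
`MurrayWilliams2018EasyWitness.lean`). The derivation of Lemma 1.3 below only ever applies
Lemma 4.1 to the non-decreasing `t = smoothQP E` (`smoothQP_mono`).
[cite: MurrayWilliams2018, Lemma 4.1 (proof)] -/
private theorem lemma_4_1_ae_monotone (h41 : MurrayWilliams2018_lemma_4_1_ae) :
    ∃ e g d : ℕ, 1 ≤ e ∧ 1 ≤ g ∧ 1 ≤ d ∧
      ∀ (s t : ℕ → ℕ), StrictMono s → IsTimeConstructible s → IsTimeConstructible t →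
        Monotone t →
        (∀ᶠ n in atTop, n * s n < 2 ^ (n / e)) →
        (∀ᶠ n in atTop, ((stretch s e)^[3] n) ^ d ≤ t n) →
        (∀ L ∈ NTIME (fun n => t n ^ e), ∀ᶠ n in atTop, L.circuitSize n ≤ s n) →
          NTIMEHasWitnessCircuits t (fun n => ((stretch s e)^[3] n) ^ (2 * g)) := by
  obtain ⟨e, g, d, he, hg, hd, H⟩ := h41
  refine ⟨e, g, d, he, hg, hd, fun s t hs hsc htc _hm ha hb hsz => ?_⟩
  apply H s t hs hsc htc
  all_goals assumption

/-- **Murray–Williams' easy witness lemma for `NQP` (Lemma 1.3), read at the tree's levels,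
from the Easy Witness Lemma for low nondeterministic time (Lemma 4.1, almost-everywhere form
`MurrayWilliams2018_lemma_4_1_ae`).** For every `k ≥ 1`: if every language of every level
`NTIME (n ^ (log₂ n)ᵉ)`, `e ≥ 1`, has circuits of size `2^{(log₂ n)ᵏ}` almost everywhere, then
for some `K` all levels have witness circuits of size `2^{(log₂ n)^K}` — exactly hypothesis
`hEWL` of `MurrayWilliams2018_thm_1_2_acc_of_EWL_of_simulation`
(`MurrayWilliams2018Hierarchy.lean`). Proof (the source, p. 11: "For `s(n) = 2^{(log n)ᵏ}`,
`NQP ⊂ SIZE[2^{(log n)ᵏ}]` implies that `NQP` has witness circuits of size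
`2^{O((log n)^{k³})}`", made to fit the tree's forms): apply
Lemma 4.1 with the strictly increasing time-constructible `s = smoothQP k + id ≥ 2^{(log₂ n)ᵏ}`
(proviso (a): `eventually_mul_smoothQP_add_lt`) and, for the level `e`, with the non-decreasing
(`smoothQP_mono`) time-constructible smooth level `t = smoothQP E`, `E = (k+2)³ + e`: the
hypothesis `NTIME (tᵉ') ⊆ SIZE[s]` a.e. comes from the assumption at the level `E + 1`
(`NTIME_smoothQP_pow_subset`), proviso (b) and
the final size `s₂(s₂(s₂(n)))^{2g} ≤ 2^{(log₂ n)^K}`, `K = (k+2)³ + 1`, are the closure of the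
bounds `2^{C (log₂ n + 2)^b}` under stretching and composition (`stretch_le_two_pow`,
`comp_le_two_pow`, `eventually_mul_log_add_two_pow_le`), and the witness circuits descend from
`smoothQP E` to the level `e` (`NTIMEHasWitnessCircuits.of_smoothQP`).
[cite: MurrayWilliams2018, Lemma 1.3 and Lemma 4.1] -/
theorem MurrayWilliams2018_lemma_1_3_of_lemma_4_1_ae (h41 : MurrayWilliams2018_lemma_4_1_ae) :
    ∀ k : ℕ, 1 ≤ k →
      (∀ e : ℕ, 1 ≤ e → ∀ L ∈ NTIME (fun n => n ^ Nat.log 2 n ^ e),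
          ∀ᶠ n in atTop, L.circuitSize n ≤ 2 ^ Nat.log 2 n ^ k) →
        ∃ K e₀ : ℕ, 1 ≤ K ∧ ∀ e : ℕ, e₀ ≤ e →
          NTIMEHasWitnessCircuits (fun n => n ^ Nat.log 2 n ^ e) (fun n => 2 ^ Nat.log 2 n ^ K) := by
  intro k hk hS
  obtain ⟨eₗ, g, d, heₗ, -, -, H⟩ := lemma_4_1_ae_monotone h41
  -- the size function and the shape of its third stretch
  have hs0 : ∀ n, (fun n => smoothQP k n + n) n ≤ 2 ^ (1 * (Nat.log 2 n + 2) ^ (k + 2)) :=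
    smoothQP_add_le_two_pow k
  have hs1 := stretch_le_two_pow (f := fun n => smoothQP k n + n) hs0 eₗ
  have hs2 := comp_le_two_pow hs1 hs1
  obtain ⟨C₃, B, hB, hs3⟩ : ∃ C₃ B : ℕ, B = (k + 2) * (k + 2) * (k + 2) ∧
      ∀ n, (stretch (fun n => smoothQP k n + n) eₗ)^[3] n ≤ 2 ^ (C₃ * (Nat.log 2 n + 2) ^ B) :=
    ⟨_, _, rfl, fun n => comp_le_two_pow hs1 hs2 n⟩
  have hB1 : 1 ≤ B := by rw [hB]; exact Nat.succ_le_of_lt (by positivity)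
  refine ⟨B + 1, 1, by omega, fun e he => ?_⟩
  -- the smooth level for the level `e`
  obtain ⟨E, hE⟩ : ∃ E : ℕ, E = B + e := ⟨_, rfl⟩
  have hE1 : 1 ≤ E := by omega
  have hEe : e + 1 ≤ E := by omega
  -- proviso (b): `s₂(s₂(s₂(n)))^d ≤ t(n)` eventually
  have hb : ∀ᶠ n in atTop,
      ((stretch (fun n => smoothQP k n + n) eₗ)^[3] n) ^ d ≤ smoothQP E n := by
    filter_upwards [eventually_mul_log_add_two_pow_le (d * C₃) B] with n hn
    calc ((stretch (fun n => smoothQP k n + n) eₗ)^[3] n) ^ d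
          ≤ 2 ^ ((d * C₃) * (Nat.log 2 n + 2) ^ B) :=
          pow_le_two_pow hs3 d n
      _ ≤ 2 ^ Nat.log 2 n ^ (B + 1) := Nat.pow_le_pow_right two_pos hn
      _ ≤ smoothQP E n := Nat.pow_le_pow_right two_pos
          ((log_pow_mono (by omega) (by omega : B + 1 ≤ E + 1) n).trans (pow_log_le_qpExp E n))
  -- the hypothesis: languages of `NTIME (tᵉ')` have `s`-size circuits almost everywhere
  have hsize : ∀ L ∈ NTIME (fun n => smoothQP E n ^ eₗ),
      ∀ᶠ n in atTop, L.circuitSize n ≤ smoothQP k n + n := by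
    intro L hL
    have hL' := NTIME_smoothQP_pow_subset hE1 heₗ hL
    filter_upwards [hS (E + 1) (by omega) L hL'] with n hn
    exact hn.trans (two_pow_log_pow_le_smoothQP_add hk n)
  have hw := H (fun n => smoothQP k n + n) (smoothQP E) (strictMono_smoothQP_add_id k)
    (isTimeConstructible_smoothQP_add_id hk) (isTimeConstructible_smoothQP hE1) (smoothQP_mono E)
    (eventually_mul_smoothQP_add_lt k heₗ) hb hsize
  -- descend to the level `e` and enlarge the size bound
  have hw' : NTIMEHasWitnessCircuits (fun n => n ^ Nat.log 2 n ^ e)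
      (fun n => ((stretch (fun n => smoothQP k n + n) eₗ)^[3] n) ^ (2 * g)) := hw.of_smoothQP hEe
  intro L hL
  refine (hw' L hL).mono ?_
  filter_upwards [eventually_mul_log_add_two_pow_le (2 * g * C₃) B] with n hn
  exact (pow_le_two_pow hs3 (2 * g) n).trans (Nat.pow_le_pow_right two_pos hn)

end Literature.Computability.Complexity

end
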